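import Literature.AlgebraicGeometry.AbelianSchemes.AbelianSchemeIsLambdaOfAtBaseChange
import Literature.AlgebraicGeometry.AbelianSchemes.IsLambdaOfAtWitnessCongruence
import Literature.AlgebraicGeometry.AbelianSchemes.IsLambdaOfAtAlongIsogeny
import Literature.AlgebraicGeometry.AbelianSchemes.RigidifiedLineBundleComapHom
import Literature.AlgebraicGeometry.Limits.SurjectiveSpread
import HarnessLib

/-!
# The polarisation clause of an isogeny quotient descends along base change: `t_y^*(ψ^*Θ − νΘ′) ∼ ψ^*Θ − νΘ′` on the
# fibre-at-`𝟙` models ([MumfordFogartyKirwan1994] Ch. 6 §2 Def. 6.2–6.3; [MumfordAV1970] §8, §23; [GortzWedhorn2020] (4.7))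

Topic `AlgebraicGeometry/AbelianSchemes`; namespaces `Literature.AlgebraicGeometry.AbelianSchemes.AbelianSchemeOver` (§1–§3)
and `….PolarizedAbelianSchemeWithLevel` (§4).  KERNEL ONLY: theorems; no definition, no named fact, no instance, no `sorry`.

Cell hodgecm-mathlib (D-0151), Hecke-link line, socket (B), node H4-ALG: the (W‴) clause of the pointwise Hecke
quotient (★ `isAdmissibleAt_heckeQuotient`, `hcompat_of_pointwiseHeckeQuotient_of_sectionKernel`) is read on the
FIBRE-AT-`𝟙` models `((A ×_S Spec Ω) ×_{Spec Ω} 𝟙)` of the two families, while the (T3b) engine ★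
`IsLambdaOfAt.pullback_isogeny` / `weilDiv_pullback_fibreHom_linEquiv_nsmul` (B-p11) reads `Λ`-witnesses on the fibres
`A_s` of the families over the base `S`.  This file closes that gap WITHOUT touching the dual-isogeny datum: the clause
DESCENDS ALONG ANY BASE CHANGE `g : S′ → S`.  Data: `S`-abelian schemes `A′, B` with dual pairs `D′, D_B`, homomorphisms
`λ′ : A′ → Â′`, `λ_B : B → B̂`, an `S`-homomorphism `ψ : A′ → B`, `ν : ℕ`, `g : S′ → S`, a point `t : Spec Ω → S′`, and
the fibre identifications `e : (A′ ×_S S′)_t ≅ A′_{t ≫ g}`, `e_B : (B ×_S S′)_t ≅ B_{t ≫ g}` (★ `fibreBaseChangeIso`).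

* §1 `isDominant_toSchemeHom_fibreHom(_baseChangeHom)` — the fibre homomorphisms of a surjective `S`-homomorphism are
  dominant (★ `Limits.surjective_pullback_map_left`);
* §2 **`toSchemeHom_fibreHom_baseChangeHom_comp_fibreBaseChangeIso_hom`** — NATURALITY `(ψ ×_S S′)_t ≫ e_B = e ≫ ψ_{t ≫ g}`
  of the fibre identification in the homomorphism (★ `fibreBaseChangeIso_hom_toSchemeHom_fst/_snd`, ★
  `fibreHom_toSchemeHom_fst/_snd`, ★ `Limits.pullback_map_left_comp_fst`, `pullback.hom_ext`), and the form
  `(ψ ×_S S′)_t = e ≫ ψ_{t ≫ g} ≫ e_B⁻¹`;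
* §3 **`linEquiv_pullback_translation_sub_baseChange`** — if at the point `t ≫ g` of `S` the pull-back `ψ_{t≫g}^*Θ₀` of
  every `Λ`-witness `Θ₀` of `λ_B` witnesses `λ′^ν` (hypothesis `H`: [MumfordAV1970] §23 «`Λ(ψ^*L) = ψ̂ ∘ Λ(L) ∘ ψ`» with
  `ψ̂ ∘ λ_B ∘ ψ = λ′^ν`, the (T3b) engine's output), then for all `Λ`-witnesses `Θ′` of `λ′ ×_S S′` and `Θ` of `λ_B ×_S S′`
  at the point `t` of `S′` (fibre-at-`t` models) and every point `y`:
  `t_y^*((ψ ×_S S′)_t^*Θ − ν•Θ′) ∼ (ψ ×_S S′)_t^*Θ − ν•Θ′`.  Proof: move `Θ′, Θ` to the fibres at `t ≫ g` (★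
  `IsLambdaOfAt.of_baseChange`), apply `H` and ★ `IsLambdaOfAt.pow_nsmul` ([MumfordAV1970] §6 Cor. 4) to get two witnesses of
  `λ′^ν`, move back (★ `IsLambdaOfAt.baseChange`), conclude by ★ `IsLambdaOfAt.linEquiv_pullback_translation_sub`
  ([MumfordAV1970] §8: `K(Θ₁ − Θ₂) = A`), and identify the divisors by §2 and `e ≫ e⁻¹ = 𝟙` (★ Cartier-divisor
  `SameDivisor`/`LinEquiv` bookkeeping);
* §4 `PolarizedAbelianSchemeWithLevel.linEquiv_pullback_translation_sub_baseChange_id` — the same for triples `P′, Q` at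
  `(g, t) := (s, 𝟙)`, stated LITERALLY as the `hW s` binder of ★ `exists_hom_baseChange_forall_pointwiseHeckeQuotient`
  (`SiegelHeckeQuotientFamilyPointwise`; plug test kernel-checked), from
  `H : ∀ t Θ₀, Q.A.IsLambdaOfAt t Q.D Q.pol.lam Θ₀ → P′.A.IsLambdaOfAt t P′.D (P′.pol.lam ^ ν) (ψ_t^*Θ₀)`.

Presearch: [MumfordAV1970] §6 Cor. 4, §8, §23 Thm. 2 (held); [MumfordFogartyKirwan1994] Ch. 6 §2 Def. 6.2–6.3 (held);
[GortzWedhorn2020] (4.7) (held); tree: ★ `AbelianSchemeIsLambdaOfAtBaseChange` (both transports along `e`), ★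
`IsLambdaOfAtWitnessCongruence`, ★ `IsLambdaOfAtAlongIsogeny` (the `A_s` model); the naturality of `e` in the
homomorphism and the descent of the clause were absent (★ `fibreEnd_baseChange_comp_fibreBaseChangeIso_hom` is the
endomorphism case in the affine carrier).  HC_CM is proved only modulo the 7 printed citations until rung 0 closes; this
file discharges none of them.

## References
* [MumfordFogartyKirwan1994] D. Mumford, J. Fogarty, F. Kirwan, *Geometric Invariant Theory*, 3rd ed. (1994), Ch. 6 §2
  Def. 6.2–6.3 (p. 120).
* [MumfordAV1970] D. Mumford, *Abelian Varieties* (1970), §6 Cor. 4, §8 (the class of `t_x^*D − D`), §23 (Thm. 2, p. 231).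
* [GortzWedhorn2020] U. Görtz, T. Wedhorn, *Algebraic Geometry I*, 2nd ed. (2020), Section (4.7) (pp. 107–108).
-/

set_option autoImplicit false

noncomputable section

universe u

open CategoryTheory CategoryTheory.Limits AlgebraicGeometry MonoidalCategory

namespace Literature.AlgebraicGeometry.AbelianSchemes

namespace AbelianSchemeOver

open Literature.AlgebraicGeometry.Motives
open scoped MonObj

variable {S S' : Scheme.{u}} {A' B : AbelianSchemeOver S} {Ω : Type u} [Field Ω]

/-! ### §1 Dominance of the fibre homomorphisms of a surjective `S`-homomorphism -/

/-- The fibre homomorphism `ψ_s : A′_s → B_s` of a surjective `S`-homomorphism is dominant (surjectivity is stable under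
base change, ★ `Limits.surjective_pullback_map_left`). [cite: GortzWedhorn2020, Section (4.7) (pp. 107–108)] -/
theorem isDominant_toSchemeHom_fibreHom (ψ : A'.X ⟶ B.X) [IsMonHom ψ] [Surjective ψ.left]
    (s : Spec (.of Ω) ⟶ S) : IsDominant (AbelianVariety.Hom.toSchemeHom (fibreHom ψ s)) := by
  haveI : Surjective ((Over.pullback s).map ψ).left := Literature.AlgebraicGeometry.Limits.surjective_pullback_map_left s ψ
  change IsDominant ((Over.pullback s).map ψ).left
  infer_instance

/-- The fibre homomorphism `(ψ ×_S S′)_t` of a surjective `S`-homomorphism is dominant (§1 applied to `ψ ×_S S′`, itself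
surjective by ★ `Limits.surjective_pullback_map_left`). [cite: GortzWedhorn2020, Section (4.7) (pp. 107–108)] -/
theorem isDominant_toSchemeHom_fibreHom_baseChangeHom (ψ : A'.X ⟶ B.X) [IsMonHom ψ] [Surjective ψ.left]
    (g : S' ⟶ S) (t : Spec (.of Ω) ⟶ S') :
    haveI := isMonHom_baseChangeHom ψ g
    IsDominant (AbelianVariety.Hom.toSchemeHom (fibreHom (baseChangeHom ψ g) t)) := by
  haveI := isMonHom_baseChangeHom ψ g
  haveI : Surjective (baseChangeHom ψ g).left := Literature.AlgebraicGeometry.Limits.surjective_pullback_map_left g ψ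
  exact isDominant_toSchemeHom_fibreHom (baseChangeHom ψ g) t

/-! ### §2 The fibre identification `(A ×_S S′)_t ≅ A_{t ≫ g}` is natural in `S`-homomorphisms -/

/-- **The fibre identification `e : (A ×_S S′)_t ≅ A_{t ≫ g}` is natural in `S`-homomorphisms**:
`(ψ ×_S S′)_t ≫ e_B = e_{A′} ≫ ψ_{t ≫ g}` on underlying schemes — both composites have the same two projections to `B`
and to `Spec Ω` (★ `fibreBaseChangeIso_hom_toSchemeHom_fst/_snd`, ★ `fibreHom_toSchemeHom_fst/_snd`, ★
`Limits.pullback_map_left_comp_fst`). [cite: GortzWedhorn2020, Section (4.7) (pp. 107–108)]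
[cite: MumfordFogartyKirwan1994, Ch. 6 §2 Definition 6.3 (p. 120)] -/
theorem toSchemeHom_fibreHom_baseChangeHom_comp_fibreBaseChangeIso_hom (ψ : A'.X ⟶ B.X) [IsMonHom ψ]
    (g : S' ⟶ S) (t : Spec (.of Ω) ⟶ S') :
    haveI := isMonHom_baseChangeHom ψ g
    AbelianVariety.Hom.toSchemeHom (fibreHom (baseChangeHom ψ g) t) ≫
        AbelianVariety.Hom.toSchemeHom (B.fibreBaseChangeIso g t).hom =
      AbelianVariety.Hom.toSchemeHom (A'.fibreBaseChangeIso g t).hom ≫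
        AbelianVariety.Hom.toSchemeHom (fibreHom ψ (t ≫ g)) := by
  haveI := isMonHom_baseChangeHom ψ g
  have h1 : AbelianVariety.Hom.toSchemeHom (fibreHom (baseChangeHom ψ g) t) ≫
      pullback.fst (B.baseChange g).X.hom t = pullback.fst (A'.baseChange g).X.hom t ≫ (baseChangeHom ψ g).left :=
    fibreHom_toSchemeHom_fst (baseChangeHom ψ g) t
  have h1' : AbelianVariety.Hom.toSchemeHom (fibreHom (baseChangeHom ψ g) t) ≫
      pullback.snd (B.baseChange g).X.hom t = pullback.snd (A'.baseChange g).X.hom t :=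
    fibreHom_toSchemeHom_snd (baseChangeHom ψ g) t
  have h2 : (baseChangeHom ψ g).left ≫ pullback.fst B.X.hom g = pullback.fst A'.X.hom g ≫ ψ.left :=
    Literature.AlgebraicGeometry.Limits.pullback_map_left_comp_fst g ψ
  have hB : AbelianVariety.Hom.toSchemeHom (B.fibreBaseChangeIso g t).hom ≫ pullback.fst B.X.hom (t ≫ g) =
      pullback.fst (B.baseChange g).X.hom t ≫ pullback.fst B.X.hom g := B.fibreBaseChangeIso_hom_toSchemeHom_fst g t
  have hB' : AbelianVariety.Hom.toSchemeHom (B.fibreBaseChangeIso g t).hom ≫ pullback.snd B.X.hom (t ≫ g) =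
      pullback.snd (B.baseChange g).X.hom t := B.fibreBaseChangeIso_hom_toSchemeHom_snd g t
  have hA : AbelianVariety.Hom.toSchemeHom (A'.fibreBaseChangeIso g t).hom ≫ pullback.fst A'.X.hom (t ≫ g) =
      pullback.fst (A'.baseChange g).X.hom t ≫ pullback.fst A'.X.hom g := A'.fibreBaseChangeIso_hom_toSchemeHom_fst g t
  have hA' : AbelianVariety.Hom.toSchemeHom (A'.fibreBaseChangeIso g t).hom ≫ pullback.snd A'.X.hom (t ≫ g) =
      pullback.snd (A'.baseChange g).X.hom t := A'.fibreBaseChangeIso_hom_toSchemeHom_snd g t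
  have hφ : AbelianVariety.Hom.toSchemeHom (fibreHom ψ (t ≫ g)) ≫ pullback.fst B.X.hom (t ≫ g) =
      pullback.fst A'.X.hom (t ≫ g) ≫ ψ.left := fibreHom_toSchemeHom_fst ψ (t ≫ g)
  have hφ' : AbelianVariety.Hom.toSchemeHom (fibreHom ψ (t ≫ g)) ≫ pullback.snd B.X.hom (t ≫ g) =
      pullback.snd A'.X.hom (t ≫ g) := fibreHom_toSchemeHom_snd ψ (t ≫ g)
  apply pullback.hom_ext
  · -- first projections to `B`: both sides are `pr_t ≫ pr_g ≫ ψ`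
    have lhs : (AbelianVariety.Hom.toSchemeHom (fibreHom (baseChangeHom ψ g) t) ≫
        AbelianVariety.Hom.toSchemeHom (B.fibreBaseChangeIso g t).hom) ≫ pullback.fst B.X.hom (t ≫ g) =
        pullback.fst (A'.baseChange g).X.hom t ≫ (pullback.fst A'.X.hom g ≫ ψ.left) :=
      (Category.assoc _ _ _).trans
        ((congrArg (AbelianVariety.Hom.toSchemeHom (fibreHom (baseChangeHom ψ g) t) ≫ ·) hB).trans
          ((Category.assoc _ _ _).symm.trans
            ((congrArg (· ≫ pullback.fst B.X.hom g) h1).trans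
              ((Category.assoc _ _ _).trans
                (congrArg (pullback.fst (A'.baseChange g).X.hom t ≫ ·) h2)))))
    have rhs : (AbelianVariety.Hom.toSchemeHom (A'.fibreBaseChangeIso g t).hom ≫
        AbelianVariety.Hom.toSchemeHom (fibreHom ψ (t ≫ g))) ≫ pullback.fst B.X.hom (t ≫ g) =
        pullback.fst (A'.baseChange g).X.hom t ≫ (pullback.fst A'.X.hom g ≫ ψ.left) :=
      (Category.assoc _ _ _).trans
        ((congrArg (AbelianVariety.Hom.toSchemeHom (A'.fibreBaseChangeIso g t).hom ≫ ·) hφ).trans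
          ((Category.assoc _ _ _).symm.trans
            ((congrArg (· ≫ ψ.left) hA).trans (Category.assoc _ _ _))))
    exact lhs.trans rhs.symm
  · -- second projections to `Spec Ω`
    have lhs : (AbelianVariety.Hom.toSchemeHom (fibreHom (baseChangeHom ψ g) t) ≫
        AbelianVariety.Hom.toSchemeHom (B.fibreBaseChangeIso g t).hom) ≫ pullback.snd B.X.hom (t ≫ g) =
        pullback.snd (A'.baseChange g).X.hom t :=
      (Category.assoc _ _ _).trans
        ((congrArg (AbelianVariety.Hom.toSchemeHom (fibreHom (baseChangeHom ψ g) t) ≫ ·) hB').trans h1')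
    have rhs : (AbelianVariety.Hom.toSchemeHom (A'.fibreBaseChangeIso g t).hom ≫
        AbelianVariety.Hom.toSchemeHom (fibreHom ψ (t ≫ g))) ≫ pullback.snd B.X.hom (t ≫ g) =
        pullback.snd (A'.baseChange g).X.hom t :=
      (Category.assoc _ _ _).trans
        ((congrArg (AbelianVariety.Hom.toSchemeHom (A'.fibreBaseChangeIso g t).hom ≫ ·) hφ').trans hA')
    exact lhs.trans rhs.symm

/-- `(ψ ×_S S′)_t = e_{A′} ≫ ψ_{t ≫ g} ≫ e_B⁻¹` (the naturality square with the inverse on the right, ★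
`toSchemeHom_fibreBaseChangeIso_hom_comp_inv`). [cite: GortzWedhorn2020, Section (4.7) (pp. 107–108)] -/
theorem toSchemeHom_fibreHom_baseChangeHom_eq (ψ : A'.X ⟶ B.X) [IsMonHom ψ] (g : S' ⟶ S)
    (t : Spec (.of Ω) ⟶ S') :
    haveI := isMonHom_baseChangeHom ψ g
    AbelianVariety.Hom.toSchemeHom (fibreHom (baseChangeHom ψ g) t) =
      (AbelianVariety.Hom.toSchemeHom (A'.fibreBaseChangeIso g t).hom ≫
        AbelianVariety.Hom.toSchemeHom (fibreHom ψ (t ≫ g))) ≫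
        AbelianVariety.Hom.toSchemeHom (B.fibreBaseChangeIso g t).inv := by
  haveI := isMonHom_baseChangeHom ψ g
  rw [← toSchemeHom_fibreHom_baseChangeHom_comp_fibreBaseChangeIso_hom, Category.assoc,
    B.toSchemeHom_fibreBaseChangeIso_hom_comp_inv g t, Category.comp_id]

/-! ### §3 The polarisation clause descends along base change -/

/-- **THE POLARISATION CLAUSE DESCENDS ALONG BASE CHANGE** (module docstring, §3): from
`H : ψ_{t≫g}^*Θ₀` witnesses `λ′^ν` whenever `Θ₀` witnesses `λ_B` (at the point `t ≫ g` of `S`), for all witnesses `Θ′` of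
`λ′ ×_S S′` and `Θ` of `λ_B ×_S S′` at the point `t` of `S′` and every point `y` of `(A′ ×_S S′)_t`:
`t_y^*((ψ ×_S S′)_t^*Θ − ν•Θ′) ∼ (ψ ×_S S′)_t^*Θ − ν•Θ′` — [MumfordAV1970] §8 (`K(Θ₁ − Θ₂) = A` for two witnesses of one
`Λ`-value, ★ `IsLambdaOfAt.linEquiv_pullback_translation_sub`) after transport along `e` (★ `IsLambdaOfAt.of_baseChange`,
★ `IsLambdaOfAt.baseChange`) and ★ `IsLambdaOfAt.pow_nsmul` ([MumfordAV1970] §6 Cor. 4).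
[cite: MumfordAV1970, §8 (the divisor class `t_x^*D − D`)] [cite: MumfordFogartyKirwan1994, Ch. 6 §2 Definition 6.2–6.3 (p. 120)]
[cite: MumfordAV1970, §23 (Thm. 2, p. 231)] -/
theorem linEquiv_pullback_translation_sub_baseChange (ψ : A'.X ⟶ B.X) [IsMonHom ψ] [Surjective ψ.left]
    (D' : A'.DualPair) (DB : B.DualPair) (lam' : A'.X ⟶ D'.hat.X) [IsMonHom lam'] (lamB : B.X ⟶ DB.hat.X) (ν : ℕ)
    (g : S' ⟶ S) (t : Spec (.of Ω) ⟶ S')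
    (H : haveI := isDominant_toSchemeHom_fibreHom ψ (t ≫ g)
      ∀ Θ₀ : CartierDivisor (B.fibre (t ≫ g)).toAbelianVariety.X.left, B.IsLambdaOfAt (t ≫ g) DB lamB Θ₀ →
        A'.IsLambdaOfAt (t ≫ g) D' (lam' ^ ν) (Θ₀.pullback (AbelianVariety.Hom.toSchemeHom (fibreHom ψ (t ≫ g)))))
    (Θ' : CartierDivisor ((A'.baseChange g).fibre t).toAbelianVariety.X.left)
    (Θ : CartierDivisor ((B.baseChange g).fibre t).toAbelianVariety.X.left)
    (hΘ' : (A'.baseChange g).IsLambdaOfAt t (D'.baseChange g) ((Over.pullback g).map lam') Θ')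
    (hΘ : (B.baseChange g).IsLambdaOfAt t (DB.baseChange g) ((Over.pullback g).map lamB) Θ)
    (y : ((A'.baseChange g).fibre t).toAbelianVariety.Points Ω) :
    haveI := isMonHom_baseChangeHom ψ g
    haveI := isDominant_toSchemeHom_fibreHom_baseChangeHom ψ g t
    ((Θ.pullback (fibreHom (baseChangeHom ψ g) t).hom.hom.hom.left + -(ν • Θ')).pullback
        (((A'.baseChange g).fibre t).toAbelianVariety.translation y).left).LinEquiv
      (Θ.pullback (fibreHom (baseChangeHom ψ g) t).hom.hom.hom.left + -(ν • Θ')) := by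
  haveI := isMonHom_baseChangeHom ψ g
  haveI hψt := isDominant_toSchemeHom_fibreHom_baseChangeHom ψ g t
  haveI hφ := isDominant_toSchemeHom_fibreHom ψ (t ≫ g)
  haveI := A'.isIso_toSchemeHom_fibreBaseChangeIso g t
  haveI := A'.isIso_toSchemeHom_fibreBaseChangeIso_inv g t
  haveI := B.isIso_toSchemeHom_fibreBaseChangeIso g t
  haveI := B.isIso_toSchemeHom_fibreBaseChangeIso_inv g t
  -- notation
  set eA := AbelianVariety.Hom.toSchemeHom (A'.fibreBaseChangeIso g t).hom with heA
  set eAi := AbelianVariety.Hom.toSchemeHom (A'.fibreBaseChangeIso g t).inv with heAi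
  set eB := AbelianVariety.Hom.toSchemeHom (B.fibreBaseChangeIso g t).hom with heB
  set eBi := AbelianVariety.Hom.toSchemeHom (B.fibreBaseChangeIso g t).inv with heBi
  set φ := AbelianVariety.Hom.toSchemeHom (fibreHom ψ (t ≫ g)) with hφdef
  set ψt := AbelianVariety.Hom.toSchemeHom (fibreHom (baseChangeHom ψ g) t) with hψtdef
  -- (1) move the two witnesses to the fibre of `A′`, `B` at `t ≫ g`
  have h'₀ : A'.IsLambdaOfAt (t ≫ g) D' lam' (Θ'.pullback eAi) := IsLambdaOfAt.of_baseChange A' g D' t lam' Θ' hΘ'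
  have h₀ : B.IsLambdaOfAt (t ≫ g) DB lamB (Θ.pullback eBi) := IsLambdaOfAt.of_baseChange B g DB t lamB Θ hΘ
  -- (2) the two witnesses of `λ′^ν` at `t ≫ g`
  have h₁ : A'.IsLambdaOfAt (t ≫ g) D' (lam' ^ ν) ((Θ.pullback eBi).pullback φ) := H _ h₀
  have h₂ : A'.IsLambdaOfAt (t ≫ g) D' (lam' ^ ν) (ν • Θ'.pullback eAi) :=
    IsLambdaOfAt.pow_nsmul A' D' lam' (t ≫ g) ν h'₀
  -- (3) back to the fibre-at-`t` model of the base change (`e^*`)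
  have h₁' := IsLambdaOfAt.baseChange A' g D' t (lam' ^ ν) _ h₁
  have h₂' := IsLambdaOfAt.baseChange A' g D' t (lam' ^ ν) _ h₂
  -- (4) two witnesses of the same value ⇒ their difference is translation invariant up to linear equivalence
  have E := IsLambdaOfAt.linEquiv_pullback_translation_sub h₁' h₂' y
  -- (5) identify the divisors: `e^*((e_B⁻¹)^*Θ ∘ ψ_{t ≫ g}) = ψ_t¹^*Θ` and `e^*(ν • (e⁻¹)^*Θ′) ∼ ν • Θ′`
  have s₁ : (A'.divisorBaseChange g t ((Θ.pullback eBi).pullback φ)).LinEquiv (Θ.pullback ψt) := by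
    refine CartierDivisor.SameDivisor.linEquiv ?_
    change (((Θ.pullback eBi).pullback φ).pullback eA).SameDivisor (Θ.pullback ψt)
    refine (CartierDivisor.pullback_pullback_sameDivisor _ φ eA).trans ?_
    refine (CartierDivisor.pullback_pullback_sameDivisor Θ eBi (eA ≫ φ)).trans ?_
    exact CartierDivisor.pullback_congr_sameDivisor Θ (toSchemeHom_fibreHom_baseChangeHom_eq ψ g t).symm
  have s₂ : (A'.divisorBaseChange g t (ν • Θ'.pullback eAi)).LinEquiv (ν • Θ') := by
    change ((ν • Θ'.pullback eAi).pullback eA).LinEquiv (ν • Θ')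
    rw [CartierDivisor.pullback_smul]
    refine (CartierDivisor.SameDivisor.linEquiv ?_).smul ν
    exact (CartierDivisor.pullback_pullback_sameDivisor Θ' eAi eA).trans
      ((CartierDivisor.pullback_congr_sameDivisor Θ' (A'.toSchemeHom_fibreBaseChangeIso_hom_comp_inv g t)).trans
        (CartierDivisor.pullback_id_sameDivisor Θ'))
  have L : (A'.divisorBaseChange g t ((Θ.pullback eBi).pullback φ) +
      -A'.divisorBaseChange g t (ν • Θ'.pullback eAi)).LinEquiv (Θ.pullback ψt + -(ν • Θ')) :=
    CartierDivisor.LinEquiv.add s₁ s₂.neg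
  exact (L.symm.pullback _).trans (E.trans L)

end AbelianSchemeOver

/-! ### §4 The clause (W‴) of the pointwise Hecke quotient, for triples, at the fibre-at-`𝟙` models -/

namespace PolarizedAbelianSchemeWithLevel

open Literature.AlgebraicGeometry.Motives AbelianSchemeOver
open scoped MonObj

variable {S : Scheme.{u}} {g N N' : ℕ} {δ δ' : Fin g → ℕ} {Ω : Type u} [Field Ω]

/-- **(W‴) for triples at the fibre-at-`𝟙` models** — LITERALLY the `hW s` binder of ★
`exists_hom_baseChange_forall_pointwiseHeckeQuotient` at `s` (plug test kernel-checked): for triples `P′, Q` over `S`, a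
surjective `S`-homomorphism `ψ : P′.A → Q.A` and `ν : ℕ` such that at EVERY point `t` of `S` the pull-back `ψ_t^*Θ₀` of a
`Λ`-witness `Θ₀` of `λ_Q` witnesses `λ_{P′}^ν` (the (T3b) engine ★ `IsLambdaOfAt.pullback_isogeny` under
`ψ ≫ λ_Q ≫ ψ^∨ = λ_{P′}^ν`), the clause `t_y^*(ψ_s¹^*Θ − ν•Θ′) ∼ ψ_s¹^*Θ − ν•Θ′` holds for all `Λ`-witnesses `Θ′, Θ` of the
triples `P′ ×_S s`, `Q ×_S s` over `Spec Ω` read at `𝟙`. [cite: MumfordAV1970, §8 (the divisor class `t_x^*D − D`)]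
[cite: MumfordFogartyKirwan1994, Ch. 6 §2 Definition 6.2–6.3 (p. 120)] -/
theorem linEquiv_pullback_translation_sub_baseChange_id (P' : PolarizedAbelianSchemeWithLevel g N' δ' S)
    (Q : PolarizedAbelianSchemeWithLevel g N δ S) (ψ : P'.A.X ⟶ Q.A.X) [IsMonHom ψ] [Surjective ψ.left] (ν : ℕ)
    (H : ∀ (t : Spec (.of Ω) ⟶ S) (Θ₀ : CartierDivisor (Q.A.fibre t).toAbelianVariety.X.left),
      haveI := isDominant_toSchemeHom_fibreHom ψ t
      Q.A.IsLambdaOfAt t Q.D Q.pol.lam Θ₀ →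
        P'.A.IsLambdaOfAt t P'.D (P'.pol.lam ^ ν) (Θ₀.pullback (AbelianVariety.Hom.toSchemeHom (fibreHom ψ t))))
    (s : Spec (.of Ω) ⟶ S) :
    haveI := isMonHom_baseChangeHom ψ s
    letI U : PolarizedAbelianSchemeWithLevel g N' δ' (Spec (.of Ω)) := P'.baseChange s
    letI Qs : PolarizedAbelianSchemeWithLevel g N δ (Spec (.of Ω)) := Q.baseChange s
    letI ψs : (U.A.fibre (𝟙 (Spec (.of Ω)))).toAbelianVariety ⟶ (Qs.A.fibre (𝟙 (Spec (.of Ω)))).toAbelianVariety :=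
      fibreHom (baseChangeHom ψ s) (𝟙 _)
    haveI : IsDominant ψs.hom.hom.hom.left := isDominant_toSchemeHom_fibreHom_baseChangeHom ψ s (𝟙 _)
    ∀ (Θ' : CartierDivisor (U.A.fibre (𝟙 (Spec (.of Ω)))).toAbelianVariety.X.left)
      (Θ : CartierDivisor (Qs.A.fibre (𝟙 (Spec (.of Ω)))).toAbelianVariety.X.left),
      U.A.IsLambdaOfAt (𝟙 (Spec (.of Ω))) U.D U.pol.lam Θ' →
      Qs.A.IsLambdaOfAt (𝟙 (Spec (.of Ω))) Qs.D Qs.pol.lam Θ →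
      ∀ y : (U.A.fibre (𝟙 (Spec (.of Ω)))).toAbelianVariety.Points Ω,
        (((Θ.pullback ψs.hom.hom.hom.left + -(ν • Θ')).pullback
          ((U.A.fibre (𝟙 (Spec (.of Ω)))).toAbelianVariety.translation y).left).LinEquiv
          (Θ.pullback ψs.hom.hom.hom.left + -(ν • Θ'))) := by
  haveI := P'.pol.isMonHom
  intro Θ' Θ hΘ' hΘ y
  exact linEquiv_pullback_translation_sub_baseChange ψ P'.D Q.D P'.pol.lam Q.pol.lam ν s (𝟙 _) (H (𝟙 _ ≫ s)) Θ' Θ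
    hΘ' hΘ y

end PolarizedAbelianSchemeWithLevel

end Literature.AlgebraicGeometry.AbelianSchemes

end
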